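import Summits.CriticalPhenomena.Ising3DConformalLimit.Theses.SynchronousCoupling
import Summits.CriticalPhenomena.Ising3DConformalLimit.Theorems.HyperoctahedralRPExistsScaleCovariantLimitBlockLimitsGiveCrux
import Summits.CriticalPhenomena.Ising3DConformalLimit.Theorems.HyperoctahedralRPExistsScaleCovariantLimitCruxIffOrbitPrecompactPointwiseLimit
import Summits.CriticalPhenomena.Ising3DConformalLimit.Theorems.HyperoctahedralRPExistsScaleCovariantLimitCompactnessItemMapsDoubling
import Summits.CriticalPhenomena.Ising3DConformalLimit.Theorems.HyperoctahedralRPLimitRotationInvariant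
import Summits.CriticalPhenomena.Ising3DConformalLimit.Theorems.HyperoctahedralRPHRP2Rigidity
import Summits.CriticalPhenomena.Ising3DConformalLimit.Theorems.SynchronousCouplingJoiningsTransferTwoBaseCroft
import Summits.CriticalPhenomena.Ising3DConformalLimit.Theorems.SynchronousCouplingJoiningsTransferMomentDiff
import Summits.CriticalPhenomena.Ising3DConformalLimit.Theorems.SynchronousCouplingJoiningsTransferBlockModel
import Summits.CriticalPhenomena.Ising3DConformalLimit.Theorems.SynchronousCouplingJoiningsTransferTowerCauchy
import Summits.CriticalPhenomena.Ising3DConformalLimit.Theorems.SynchronousCouplingJoiningsTransferBallSumRatio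
import Summits.CriticalPhenomena.Ising3DConformalLimit.Theorems.SynchronousCouplingJoiningsTransferSlabVariance
import Summits.CriticalPhenomena.Ising3DConformalLimit.Theorems.SynchronousCouplingJoiningsTransferLogContinuity
import HarnessLib

/-!
# `JoiningsTransfer` (crux stmt-CriticalPhenomena-18764 of route `SynchronousCoupling`) — PROVED
(line `Sketch`, card `Cruxes/JoiningsTransfer/Ideas/towers-to-all-scales-croft.md`; lead prover-line-stmt-CriticalPhenomena-18764-0)

The crux is the reduction `DilationJoinings → RotationJoining → UniformRegularity → (PL) ∧ (ROT)`:
* (PL) — item 6153 verbatim: for every `n` and non-coincident `x` the pinned rescaled critical correlator of the nearest-neighbour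
  Ising model on `ℤ³` converges as `δ → 0⁺`;
* (ROT) — every normalised, non-degenerate, translation-invariant, scale-covariant pointwise scaling limit `S` of `criticalCorr 3` is
  rotation invariant.

(ROT) is the tree's `LimitRotationInvariant_of HRP2Rigidity_of` (route `HyperoctahedralRP`, items 1980/1979). (PL) is obtained through the
LANDED funnel `ExistsScaleCovariantLimit_of_blockLimits` → `pointwiseLimit_of_existsScaleCovariantLimit` from
`BlockLimits` (convergence as `L → ∞` of every normalised block moment `R_n(L;k) = critBlockMoment n L k`), which this line proves from
`DilationJoinings ∧ UniformRegularity` by seven landed stubs: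

* `stub_towerCauchy` (D): the dilation joinings give BASE-UNIFORM tower rates `|R_n(pL;k) − R_n(L;k)| ≤ C L^{-θ}`, `p = 2, 3`, all `L ≥ 1`
  (coupling marginals + moment-difference inequality `stub_momentDiff` (B) + block-model dictionary `stub_blockModel` (C) + Newman bounds);
* `stub_logContinuity` (E3): `R_n(·;k)` is asymptotically continuous in `log L` (slab variance `stub_slabVariance` (E2) of the symmetric
  difference of two blocks, ball-sum ratio `stub_ballSumRatio` (E1) from `TwoPointDoubling` = `UniformRegularity` (item maps), B, C);
* `stub_twoBaseCroft` (A): a bare real sequence with base-uniform 2- and 3-tower rates that is log-continuous converges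
  (`Φ(L) = lim_j R(2^j L)` is exactly ×2- and ×3-invariant and log-uniformly continuous, hence constant by density of `ℤ log 2 + ℤ log 3`).

`RotationJoining` is not used. References: G. Kozma, Acta Math. 199 (2007) §6.1 (two-prime coupling architecture for 3D LERW);
C. M. Newman, Z. Wahrsch. 33 (1975); A. Messager, S. Miracle-Solé, J. Stat. Phys. 17 (1977); H. Duminil-Copin, ICM 2022 §8.4.
No definitions, no named-fact hypotheses, no `sorry`.
-/

noncomputable section

namespace Summit.CriticalPhenomena.Ising3DConformalLimit.Cruxes.JoiningsTransfer.Sketch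

open Literature.Probability.LatticeModels MeasureTheory Filter Set
open scoped Topology BigOperators
open Summit.CriticalPhenomena.Ising3DConformalLimit.Theses
open Summit.CriticalPhenomena.Ising3DConformalLimit.Cruxes.ExistsScaleCovariantLimit.MonotoneBlockingPort
open Summit.CriticalPhenomena.Ising3DConformalLimit.Cruxes.ExistsScaleCovariantLimit.TwoHierarchies
  (pointwiseLimit_of_existsScaleCovariantLimit)
open Summit.CriticalPhenomena.Ising3DConformalLimit.Cruxes.ExistsScaleCovariantLimit.TwoHierarchies.ItemMaps
  (uniformRegularity_iff_doubling)
open Summit.CriticalPhenomena.Ising3DConformalLimit.Cruxes.LimitRotationInvariant.QuarterTurnLiouville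
  (LimitRotationInvariant_of)
open Summit.CriticalPhenomena.Ising3DConformalLimit.Cruxes.HRP2Rigidity.XRayMellin (HRP2Rigidity_of)

/-- The hypothesis `UniformRegularity` of route `SynchronousCoupling` is item 4658 verbatim, i.e. `MonotoneRG.UniformRegularity`.
[folklore] -/
theorem synchronousCoupling_uniformRegularity_iff :
    SynchronousCoupling.UniformRegularity ↔ MonotoneRG.UniformRegularity := Iff.rfl

/-- **Tower rates** of every normalised critical block moment from the dilation joinings (stubs B, C, D). [folklore] -/
theorem towers_of_dilationJoinings (hDJ : SynchronousCoupling.DilationJoinings) (n : ℕ) (k : Fin n → Site 3) :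
    ∃ C θ : ℝ, 0 < θ ∧ ∀ L : ℕ, 1 ≤ L →
      |critBlockMoment n (2 * L) k - critBlockMoment n L k| ≤ C * (L : ℝ) ^ (-θ) ∧
      |critBlockMoment n (3 * L) k - critBlockMoment n L k| ≤ C * (L : ℝ) ^ (-θ) :=
  stub_towerCauchy stub_momentDiff stub_blockModel hDJ n k

/-- **Log-continuity** of every normalised critical block moment from two-point doubling (stubs B, C, E1, E2, E3). [folklore] -/
theorem logContinuity_of_doubling (hD : MirrorHoelderCompactness.TwoPointDoubling) (n : ℕ) (k : Fin n → Site 3)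
    (ε : ℝ) (hε : 0 < ε) :
    ∃ s : ℝ, 0 < s ∧ ∃ L₀ : ℕ, ∀ L L' : ℕ, L₀ ≤ L → L ≤ L' →
      (L' : ℝ) ≤ (1 + s) * L → |critBlockMoment n L' k - critBlockMoment n L k| ≤ ε :=
  stub_logContinuity stub_momentDiff stub_blockModel (stub_slabVariance (stub_ballSumRatio hD)) n k ε hε

/-- **`DilationJoinings ∧ UniformRegularity ⟹ BlockLimits`**: every normalised block moment `R_n(L;k)` of the critical `ℤ³` Ising
model converges as `L → ∞` (two-base Croft lemma, stub A, on the tower rates and the log-continuity). [folklore] -/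
theorem blockLimits_of_joinings (hDJ : SynchronousCoupling.DilationJoinings) (hUR : SynchronousCoupling.UniformRegularity) :
    BlockLimits := by
  intro n _hn k _hk
  have hD : MirrorHoelderCompactness.TwoPointDoubling :=
    uniformRegularity_iff_doubling.1 (synchronousCoupling_uniformRegularity_iff.1 hUR)
  exact stub_twoBaseCroft (fun L => critBlockMoment n L k) (towers_of_dilationJoinings hDJ n k)
    (fun ε hε => logContinuity_of_doubling hD n k ε hε)

/-- **`DilationJoinings ∧ UniformRegularity ⟹` the scale-covariant scaling limit of the critical `ℤ³` Ising correlators exists**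
(item 1981 of route `HyperoctahedralRP`, via the landed `ExistsScaleCovariantLimit_of_blockLimits`). [folklore] -/
theorem existsScaleCovariantLimit_of_joinings (hDJ : SynchronousCoupling.DilationJoinings)
    (hUR : SynchronousCoupling.UniformRegularity) :
    Summit.CriticalPhenomena.Ising3DConformalLimit.Theses.HyperoctahedralRP.ExistsScaleCovariantLimit :=
  ExistsScaleCovariantLimit_of_blockLimits (blockLimits_of_joinings hDJ hUR)

/-- **THE CRUX `JoiningsTransfer`** (stmt-CriticalPhenomena-18764): `DilationJoinings → RotationJoining → UniformRegularity →
(PL) ∧ (ROT)`. (PL) by the landed funnel applied to `blockLimits_of_joinings`; (ROT) is the tree's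
`LimitRotationInvariant_of HRP2Rigidity_of`; `RotationJoining` is unused. [folklore] -/
theorem JoiningsTransfer_proof :
    Summit.CriticalPhenomena.Ising3DConformalLimit.Theses.SynchronousCoupling.JoiningsTransfer := by
  intro hDJ _hRJ hUR
  exact ⟨pointwiseLimit_of_existsScaleCovariantLimit (existsScaleCovariantLimit_of_joinings hDJ hUR),
    LimitRotationInvariant_of HRP2Rigidity_of⟩

end Summit.CriticalPhenomena.Ising3DConformalLimit.Cruxes.JoiningsTransfer.Sketch

end
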